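import Summits.KontsevichZagierPeriods.KontsevichZagierPeriods.Theses.SymplecticScissors
import Literature.NumberTheory.Transcendental.CurvePeriodsPathApproxProofs
import Literature.NumberTheory.Transcendental.SemialgebraicLineDeriv
import Literature.NumberTheory.Transcendental.KZSemialgebraicComplex
import Literature.NumberTheory.Transcendental.KZPeriodsProofs

/-!
# Stub `stub_saHomotopic` of crux `SymplecticScissors.RealOnePeriodRelations`
# (stmt-KontsevichZagierPeriods-10042, line `nash-retraction-thin-strip`) — auxiliary pieces

Generic building blocks for the semialgebraic representative `γ'` of the homotopy class of a `C¹`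
path `γ` on a smooth affine curve and for the explicit homotopy `γ ≃ γ'`:
* `flatStep` — the flat cubic step `φ(u) = 3u² − 2u³` clamped to `[0,1]`; it is `C¹` on `ℝ`
  (`contDiff_flatStep`) and `ℚ`-semialgebraic (`isSemialgebraicFunOn_flatStep`), so that
  `t ↦ σ(φ(N t − r))` concatenates `C¹` semialgebraic pieces `σ` into a `C¹` semialgebraic path
  (the device of the tree's `CurvePeriods.exists_curvePath_of_path`, `Real.smoothTransition`
  replaced by `φ`);
* `link` — the chart-straight segment `ψ((1 − v)·aᵢ₀ + v·bᵢ₀)` between two points of a chart region;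
* `pieceA` — the `r`-th piece of the link-insertion homotopy (at parameter `s`: back along
  `λ_r|[0,s]`, along `γ|[r/N,(r+1)/N]`, along `λ_{r+1}|[0,s]`, on the three thirds of the piece
  interval), ONE sum of globally continuous maps;
* `pieceB` — the `r`-th piece of the chart-straight homotopy between two paths of one chart region.

References: A. Huber, G. Wüstholz, *Transcendence and Linear Relations of 1-Periods* (CUP 2022),
§3.3.1; J. Bochnak, M. Coste, M.-F. Roy, *Real Algebraic Geometry* (1998), §2.2.
-/

noncomputable section

open scoped BigOperators Topology unitInterval
open Set Filter Metric MvPolynomial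
open Literature.NumberTheory.Transcendental Literature.NumberTheory.Transcendental.CurvePeriods
open Literature.ModelTheory.ExponentialFields (IsSemialgebraic)

namespace Summit.KontsevichZagierPeriods.SymplecticScissors.RealOnePeriodRelations.SaHomotopic

/-! ### Clamping -/

/-- Below `0` the clamp is `0`. [folklore] -/
theorem clamp01_of_nonpos {u : ℝ} (hu : u ≤ 0) : clamp01 u = 0 :=
  max_eq_left (min_le_of_left_le hu)

/-- Above `1` the clamp is `1`. [folklore] -/
theorem clamp01_of_one_le {u : ℝ} (hu : 1 ≤ u) : clamp01 u = 1 := by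
  unfold clamp01
  rw [min_eq_right hu, max_eq_right zero_le_one]

/-! ### The flat cubic step -/

/-- The **flat cubic step** `φ(u) = 3u² − 2u³` on `[0,1]`, extended by `0` on `u ≤ 0` and by `1` on
`u ≥ 1` (`smoothStep ∘ clamp01`): a `C¹` and `ℚ`-semialgebraic replacement of
`Real.smoothTransition`. [folklore] -/
def flatStep (u : ℝ) : ℝ := smoothStep (clamp01 u)

/-- `φ(u) = 0` for `u ≤ 0`. [folklore] -/
theorem flatStep_of_nonpos {u : ℝ} (hu : u ≤ 0) : flatStep u = 0 := by
  unfold flatStep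
  rw [clamp01_of_nonpos hu, smoothStep_zero]

/-- `φ(u) = 1` for `u ≥ 1`. [folklore] -/
theorem flatStep_of_one_le {u : ℝ} (hu : 1 ≤ u) : flatStep u = 1 := by
  unfold flatStep
  rw [clamp01_of_one_le hu, smoothStep_one]

/-- `φ = smoothStep` on `[0,1]`. [folklore] -/
theorem flatStep_of_mem {u : ℝ} (hu : u ∈ Icc (0 : ℝ) 1) : flatStep u = smoothStep u := by
  unfold flatStep
  rw [clamp01_of_mem hu]

/-- `φ(ℝ) ⊆ [0,1]`. [folklore] -/
theorem flatStep_mem (u : ℝ) : flatStep u ∈ Icc (0 : ℝ) 1 := mapsTo_smoothStep (clamp01_mem u)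

/-- `φ` is continuous. [folklore] -/
theorem continuous_flatStep : Continuous flatStep :=
  (contDiff_smoothStep (n := 0)).continuous.comp continuous_clamp01

/-- The derivative `φ′(u) = 6 c (1 − c)`, `c = clamp01 u` (vanishing off `(0,1)`). [folklore] -/
def flatStepDeriv (u : ℝ) : ℝ := 6 * clamp01 u * (1 - clamp01 u)

/-- `φ′` is continuous. [folklore] -/
theorem continuous_flatStepDeriv : Continuous flatStepDeriv :=
  (continuous_const.mul continuous_clamp01).mul (continuous_const.sub continuous_clamp01)

/-- `φ` has derivative `φ′(u)` at every `u` (one-sided gluing at `u = 0, 1`, where both one-sided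
derivatives vanish). [folklore] -/
theorem hasDerivAt_flatStep (u : ℝ) : HasDerivAt flatStep (flatStepDeriv u) u := by
  -- one-sided pieces
  have hL : ∀ v ≤ (0 : ℝ), HasDerivWithinAt flatStep 0 (Iic 0) v := fun v hv =>
    (hasDerivWithinAt_const v (Iic 0) (0 : ℝ)).congr
      (fun x hx => flatStep_of_nonpos hx) (flatStep_of_nonpos hv)
  have hR : ∀ v, (1 : ℝ) ≤ v → HasDerivWithinAt flatStep 0 (Ici 1) v := fun v hv =>
    (hasDerivWithinAt_const v (Ici 1) (1 : ℝ)).congr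
      (fun x hx => flatStep_of_one_le hx) (flatStep_of_one_le hv)
  have hM : ∀ v ∈ Icc (0 : ℝ) 1,
      HasDerivWithinAt flatStep (6 * v * (1 - v)) (Icc 0 1) v := fun v hv =>
    (hasDerivAt_smoothStep v).hasDerivWithinAt.congr (fun x hx => flatStep_of_mem hx)
      (flatStep_of_mem hv)
  rcases lt_trichotomy u 0 with hu | rfl | hu
  · -- `u < 0`: locally `0`
    have hd : flatStepDeriv u = 0 := by simp [flatStepDeriv, clamp01_of_nonpos hu.le]
    rw [hd]
    exact (hL u hu.le).hasDerivAt (Iic_mem_nhds hu)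
  · have hd : flatStepDeriv 0 = 0 := by simp [flatStepDeriv, clamp01_of_nonpos le_rfl]
    rw [hd]
    have h2 : HasDerivWithinAt flatStep 0 (Ici 0) 0 := by
      have := hM 0 ⟨le_rfl, zero_le_one⟩
      rw [mul_zero, zero_mul] at this
      exact this.mono_of_mem_nhdsWithin (Icc_mem_nhdsGE zero_lt_one)
    have h := (hL 0 le_rfl).union h2
    rwa [Iic_union_Ici, hasDerivWithinAt_univ] at h
  rcases lt_trichotomy u 1 with hu1 | rfl | hu1
  · have hd : flatStepDeriv u = 6 * u * (1 - u) := by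
      simp [flatStepDeriv, clamp01_of_mem ⟨hu.le, hu1.le⟩]
    rw [hd]
    exact (hM u ⟨hu.le, hu1.le⟩).hasDerivAt (Icc_mem_nhds hu hu1)
  · have hd : flatStepDeriv 1 = 0 := by simp [flatStepDeriv, clamp01_of_one_le le_rfl]
    rw [hd]
    have h1 : HasDerivWithinAt flatStep 0 (Iic 1) 1 := by
      have := hM 1 ⟨zero_le_one, le_rfl⟩
      rw [sub_self, mul_zero] at this
      exact this.mono_of_mem_nhdsWithin (Icc_mem_nhdsLE zero_lt_one)
    have h := h1.union (hR 1 le_rfl)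
    rwa [Iic_union_Ici, hasDerivWithinAt_univ] at h
  · have hd : flatStepDeriv u = 0 := by simp [flatStepDeriv, clamp01_of_one_le hu1.le]
    rw [hd]
    exact (hR u hu1.le).hasDerivAt (Ici_mem_nhds hu1)

/-- **`φ` is `C¹` on `ℝ`.** [folklore] -/
theorem contDiff_flatStep : ContDiff ℝ 1 flatStep := by
  rw [contDiff_one_iff_deriv, show deriv flatStep = flatStepDeriv from
    funext fun u => (hasDerivAt_flatStep u).deriv]
  exact ⟨fun u => (hasDerivAt_flatStep u).differentiableAt, continuous_flatStepDeriv⟩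

/-- **`φ` is `ℚ`-semialgebraic**: for a polynomial `L ∈ ℚ[t]` the function `t ↦ φ(L(t))` on `ℝ¹`
has the semialgebraic graph `{L ≤ 0, y = 0} ∪ {0 ≤ L ≤ 1, y = 3L² − 2L³} ∪ {1 ≤ L, y = 1}`.
[cite: BochnakCosteRoy1998, §2.2] -/
theorem isSemialgebraicFunOn_flatStep (L : MvPolynomial (Fin 1) ℚ) :
    IsSemialgebraicFunOn ℚ (univ : Set (Fin 1 → ℝ)) (fun z => flatStep (aeval z L)) := by
  have hW₁ : IsSemialgebraic ℚ {z : Fin 1 → ℝ | aeval z L ≤ aeval z (0 : MvPolynomial (Fin 1) ℚ)} :=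
    Literature.ModelTheory.ExponentialFields.isSemialgebraic_setOf_eval_le _ _
  have hW₂ : IsSemialgebraic ℚ ({z : Fin 1 → ℝ | aeval z (0 : MvPolynomial (Fin 1) ℚ) ≤ aeval z L} ∩
      {z : Fin 1 → ℝ | aeval z L ≤ aeval z (1 : MvPolynomial (Fin 1) ℚ)}) :=
    (Literature.ModelTheory.ExponentialFields.isSemialgebraic_setOf_eval_le _ _).inter
      (Literature.ModelTheory.ExponentialFields.isSemialgebraic_setOf_eval_le _ _)
  have hW₃ : IsSemialgebraic ℚ {z : Fin 1 → ℝ | aeval z (1 : MvPolynomial (Fin 1) ℚ) ≤ aeval z L} :=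
    Literature.ModelTheory.ExponentialFields.isSemialgebraic_setOf_eval_le _ _
  have h₁ := (isSemialgebraicFunOn_aeval hW₁ (0 : MvPolynomial (Fin 1) ℚ))
  have h₂ := (isSemialgebraicFunOn_aeval hW₂ (L * L * (3 - 2 * L)))
  have h₃ := (isSemialgebraicFunOn_aeval hW₃ (1 : MvPolynomial (Fin 1) ℚ))
  have h12 := IsSemialgebraicFunOn.union (F := fun z => flatStep (aeval z L)) h₁ h₂
    (fun z hz => by
      simp only [mem_setOf_eq, map_zero] at hz
      show flatStep (aeval z L) = aeval z 0
      rw [flatStep_of_nonpos hz, map_zero])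
    (fun z hz => by
      simp only [mem_inter_iff, mem_setOf_eq, map_zero, map_one] at hz
      show flatStep (aeval z L) = aeval z (L * L * (3 - 2 * L))
      rw [flatStep_of_mem hz]
      simp [smoothStep])
  have h := IsSemialgebraicFunOn.union (F := fun z => flatStep (aeval z L)) h12 h₃ (fun _ _ => rfl)
    (fun z hz => by
      simp only [mem_setOf_eq, map_one] at hz
      show flatStep (aeval z L) = aeval z 1
      rw [flatStep_of_one_le hz, map_one])
  convert h using 1
  symm
  refine eq_univ_of_forall fun z => ?_
  simp only [mem_union, mem_inter_iff, mem_setOf_eq, map_zero, map_one]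
  rcases le_total (aeval z L) 0 with h0 | h0
  · exact Or.inl (Or.inl h0)
  rcases le_total (aeval z L) 1 with h1 | h1
  · exact Or.inl (Or.inr ⟨h0, h1⟩)
  · exact Or.inr h1

/-- The case used below: `t ↦ φ(N t − r)` is `ℚ`-semialgebraic on every `ℚ`-semialgebraic
`W ⊆ ℝ¹`. [cite: BochnakCosteRoy1998, §2.2] -/
theorem isSemialgebraicFunOn_flatStep_affine {W : Set (Fin 1 → ℝ)} (hW : IsSemialgebraic ℚ W)
    (N r : ℕ) : IsSemialgebraicFunOn ℚ W (fun z => flatStep ((N : ℝ) * z 0 - r)) := by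
  have h := (isSemialgebraicFunOn_flatStep (C (N : ℚ) * X 0 - C (r : ℚ))).mono (subset_univ W) hW
  refine h.congr fun z _ => ?_
  simp

/-! ### Chart-straight links -/

section Pieces

variable {n : ℕ}

/-- The **chart-straight link** from `a` to `b` in the chart `ψ` over the coordinate `i₀`:
`v ↦ ψ((1 − v)·aᵢ₀ + v·bᵢ₀)`, the parameter clamped to `[0,1]`. [folklore] -/
def link (ψ : ℂ → (Fin n → ℂ)) (i₀ : Fin n) (a b : Fin n → ℂ) (v : ℝ) : Fin n → ℂ :=
  ψ (segPoint (a i₀) (b i₀) (clamp01 v))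

variable {ψ : ℂ → (Fin n → ℂ)} {i₀ : Fin n} {a b : Fin n → ℂ} {T : Set ℂ} {S : Set (Fin n → ℂ)}

/-- The argument of `ψ` in the link lies in the (convex) chart disc. [folklore] -/
theorem link_arg_mem (hT : Convex ℝ T) (ha : a i₀ ∈ T) (hb : b i₀ ∈ T) (v : ℝ) :
    segPoint (a i₀) (b i₀) (clamp01 v) ∈ T :=
  segPoint_mem hT ha hb (clamp01_mem v)

/-- The link is continuous on `ℝ`. [folklore] -/
theorem continuous_link (hT : Convex ℝ T) (hψ : ContinuousOn ψ T) (ha : a i₀ ∈ T)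
    (hb : b i₀ ∈ T) : Continuous (link ψ i₀ a b) :=
  hψ.comp_continuous ((contDiff_segPoint _ _ (n := 0)).continuous.comp continuous_clamp01)
    (link_arg_mem hT ha hb)

/-- The link takes values in the image of the chart disc. [folklore] -/
theorem link_mem (hT : Convex ℝ T) (hS : MapsTo ψ T S) (ha : a i₀ ∈ T) (hb : b i₀ ∈ T)
    (v : ℝ) : link ψ i₀ a b v ∈ S :=
  hS (link_arg_mem hT ha hb v)

/-- `link 0 = ψ(aᵢ₀)`. [folklore] -/
theorem link_zero : link ψ i₀ a b 0 = ψ (a i₀) := by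
  unfold link
  rw [clamp01_of_nonpos le_rfl, segPoint_zero]

/-- `link 1 = ψ(bᵢ₀)`. [folklore] -/
theorem link_one : link ψ i₀ a b 1 = ψ (b i₀) := by
  unfold link
  rw [clamp01_of_one_le le_rfl, segPoint_one]

/-- A link from a point to itself is constant. [folklore] -/
theorem link_self (h : ψ (a i₀) = a) (v : ℝ) : link ψ i₀ a a v = a := by
  unfold link
  rw [segPoint_self, h]

/-! ### The pieces of the link-insertion homotopy -/

/-- The `r`-th **piece of the link-insertion homotopy** (`u = N t − r` the local parameter): at
`s` it runs `λ_r(s(1 − 3u))` on the first third, `P(r/N + (3u − 1)/N)` on the middle third and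
`λ_{r+1}(s(3u − 2))` on the last third — written as one sum of globally continuous maps, constant
`= λ_r(s)` for `t ≤ r/N` and `= λ_{r+1}(s)` for `t ≥ (r+1)/N`. [folklore] -/
def pieceA (P : ℝ → (Fin n → ℂ)) (lam : ℕ → ℝ → (Fin n → ℂ)) (N r : ℕ) (q : ℝ × ℝ) :
    Fin n → ℂ :=
  lam r (q.1 * clamp01 (1 - 3 * ((N : ℝ) * q.2 - r))) +
    (P ((r : ℝ) / N + clamp01 (3 * ((N : ℝ) * q.2 - r) - 1) / N) - P ((r : ℝ) / N)) +
    (lam (r + 1) (q.1 * clamp01 (3 * ((N : ℝ) * q.2 - r) - 2)) - P (((r : ℝ) + 1) / N))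

variable {P : ℝ → (Fin n → ℂ)} {lam : ℕ → ℝ → (Fin n → ℂ)} {N r : ℕ}

/-- `r/N + 1/N = (r+1)/N`. [folklore] -/
theorem div_add_one_div (N r : ℕ) : (r : ℝ) / N + 1 / N = ((r : ℝ) + 1) / N := by
  rw [add_div]

/-- Before the piece: `pieceA (s, t) = λ_r(s)` for `t ≤ r/N`. [folklore] -/
theorem pieceA_of_le (hN : 0 < N) (h0' : lam (r + 1) 0 = P (((r : ℝ) + 1) / N)) {s t : ℝ}
    (ht : t ≤ (r : ℝ) / N) : pieceA P lam N r (s, t) = lam r s := by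
  have hN' : (0 : ℝ) < N := by exact_mod_cast hN
  have hu : (N : ℝ) * t - r ≤ 0 := by
    have := (le_div_iff₀ hN').mp ht
    linarith [mul_comm (N : ℝ) t]
  unfold pieceA
  simp only
  rw [clamp01_of_one_le (by linarith : (1 : ℝ) ≤ 1 - 3 * ((N : ℝ) * t - r)),
    clamp01_of_nonpos (by linarith : 3 * ((N : ℝ) * t - r) - 1 ≤ 0),
    clamp01_of_nonpos (by linarith : 3 * ((N : ℝ) * t - r) - 2 ≤ 0), mul_one, mul_zero,
    zero_div, add_zero, h0', sub_self, sub_self, add_zero, add_zero]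

/-- After the piece: `pieceA (s, t) = λ_{r+1}(s)` for `t ≥ (r+1)/N`. [folklore] -/
theorem pieceA_of_ge (hN : 0 < N) (h0 : lam r 0 = P ((r : ℝ) / N)) {s t : ℝ}
    (ht : ((r : ℝ) + 1) / N ≤ t) : pieceA P lam N r (s, t) = lam (r + 1) s := by
  have hN' : (0 : ℝ) < N := by exact_mod_cast hN
  have hu : 1 ≤ (N : ℝ) * t - r := by
    have := (div_le_iff₀ hN').mp ht
    linarith [mul_comm (N : ℝ) t]
  unfold pieceA
  simp only
  rw [clamp01_of_nonpos (by linarith : 1 - 3 * ((N : ℝ) * t - r) ≤ 0),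
    clamp01_of_one_le (by linarith : (1 : ℝ) ≤ 3 * ((N : ℝ) * t - r) - 1),
    clamp01_of_one_le (by linarith : (1 : ℝ) ≤ 3 * ((N : ℝ) * t - r) - 2), mul_one, mul_zero,
    h0, div_add_one_div]
  abel

/-- At `s = 0` the piece is the reparametrised path `P(r/N + clamp01(3u − 1)/N)`. [folklore] -/
theorem pieceA_zero_left (h0 : lam r 0 = P ((r : ℝ) / N))
    (h0' : lam (r + 1) 0 = P (((r : ℝ) + 1) / N)) (t : ℝ) :
    pieceA P lam N r (0, t) = P ((r : ℝ) / N + clamp01 (3 * ((N : ℝ) * t - r) - 1) / N) := by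
  unfold pieceA
  simp only
  rw [zero_mul, zero_mul, h0, h0']
  abel

/-- The piece is continuous on `ℝ²`. [folklore] -/
theorem continuous_pieceA (hP : Continuous P) (hl : Continuous (lam r))
    (hl' : Continuous (lam (r + 1))) : Continuous (pieceA P lam N r) := by
  have hu : Continuous fun q : ℝ × ℝ => (N : ℝ) * q.2 - r :=
    (continuous_const.mul continuous_snd).sub continuous_const
  unfold pieceA
  refine ((hl.comp (continuous_fst.mul (continuous_clamp01.comp (continuous_const.sub
    (continuous_const.mul hu))))).add ((hP.comp (continuous_const.add
    ((continuous_clamp01.comp ((continuous_const.mul hu).sub continuous_const)).div_const _))).sub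
    continuous_const)).add ((hl'.comp (continuous_fst.mul (continuous_clamp01.comp
    ((continuous_const.mul hu).sub continuous_const)))).sub continuous_const)

/-- The reparametrised time of the middle third lies in the piece interval. [folklore] -/
theorem div_add_clamp01_div_mem (hN : 0 < N) (x : ℝ) :
    (r : ℝ) / N + clamp01 x / N ∈ Icc ((r : ℝ) / N) (((r : ℝ) + 1) / N) := by
  have hN' : (0 : ℝ) < N := by exact_mod_cast hN
  have hc := clamp01_mem x
  refine ⟨le_add_of_nonneg_right (div_nonneg hc.1 hN'.le), ?_⟩
  rw [← div_add_one_div]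
  gcongr
  exact hc.2

/-- **The piece stays in any set containing the two links and the path piece**: on each third
exactly one summand is active. [folklore] -/
theorem pieceA_mem (hN : 0 < N) (h0 : lam r 0 = P ((r : ℝ) / N))
    (h0' : lam (r + 1) 0 = P (((r : ℝ) + 1) / N)) (hlS : ∀ v, lam r v ∈ S)
    (hl'S : ∀ v, lam (r + 1) v ∈ S)
    (hPS : ∀ t ∈ Icc ((r : ℝ) / N) (((r : ℝ) + 1) / N), P t ∈ S) (s t : ℝ) :
    pieceA P lam N r (s, t) ∈ S := by
  unfold pieceA
  simp only
  set u : ℝ := (N : ℝ) * t - r with hu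
  rcases le_total u (1 / 3) with h1 | h1
  · -- first third: only the first link moves
    rw [clamp01_of_nonpos (by linarith : 3 * u - 1 ≤ 0),
      clamp01_of_nonpos (by linarith : 3 * u - 2 ≤ 0), zero_div, add_zero, sub_self, add_zero,
      mul_zero, h0', sub_self, add_zero]
    exact hlS _
  rcases le_total u (2 / 3) with h2 | h2
  · -- middle third: only the path moves
    rw [clamp01_of_nonpos (by linarith : 1 - 3 * u ≤ 0),
      clamp01_of_nonpos (by linarith : 3 * u - 2 ≤ 0), mul_zero, h0, h0',
      sub_self, add_zero, add_sub_cancel]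
    exact hPS _ (div_add_clamp01_div_mem hN _)
  · -- last third: only the second link moves
    rw [clamp01_of_nonpos (by linarith : 1 - 3 * u ≤ 0),
      clamp01_of_one_le (by linarith : (1 : ℝ) ≤ 3 * u - 1), mul_zero, h0, div_add_one_div,
      add_sub_cancel, add_sub_cancel]
    exact hl'S _

/-! ### The pieces of the chart-straight homotopy -/

/-- The `r`-th **piece of the chart-straight homotopy** from the path `A` to the path `B` (both
in one chart region, coordinate `i₀`): `(s, t) ↦ ψ((1 − s)·A(t)ᵢ₀ + s·B(t)ᵢ₀)`, `s` clamped to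
`[0,1]`. [folklore] -/
def pieceB (ψ : ℂ → (Fin n → ℂ)) (i₀ : Fin n) (A B : ℝ → (Fin n → ℂ)) (q : ℝ × ℝ) :
    Fin n → ℂ :=
  ψ (segPoint (A q.2 i₀) (B q.2 i₀) (clamp01 q.1))

variable {A B : ℝ → (Fin n → ℂ)}

/-- The argument of `ψ` in `pieceB` lies in the (convex) chart disc. [folklore] -/
theorem pieceB_arg_mem (hT : Convex ℝ T) (hA : ∀ t, A t i₀ ∈ T) (hB : ∀ t, B t i₀ ∈ T)
    (q : ℝ × ℝ) : segPoint (A q.2 i₀) (B q.2 i₀) (clamp01 q.1) ∈ T :=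
  segPoint_mem hT (hA _) (hB _) (clamp01_mem _)

/-- The chart-straight piece is continuous on `ℝ²`. [folklore] -/
theorem continuous_pieceB (hT : Convex ℝ T) (hψ : ContinuousOn ψ T) (hAc : Continuous A)
    (hBc : Continuous B) (hA : ∀ t, A t i₀ ∈ T) (hB : ∀ t, B t i₀ ∈ T) :
    Continuous (pieceB ψ i₀ A B) := by
  have h1 : Continuous fun q : ℝ × ℝ => A q.2 i₀ := (continuous_apply i₀).comp (hAc.comp continuous_snd)
  have h2 : Continuous fun q : ℝ × ℝ => B q.2 i₀ := (continuous_apply i₀).comp (hBc.comp continuous_snd)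
  have h3 : Continuous fun q : ℝ × ℝ => clamp01 q.1 := continuous_clamp01.comp continuous_fst
  refine hψ.comp_continuous ?_ (pieceB_arg_mem hT hA hB)
  show Continuous fun q : ℝ × ℝ =>
    (((1 - clamp01 q.1 : ℝ) : ℂ) * A q.2 i₀ + ((clamp01 q.1 : ℝ) : ℂ) * B q.2 i₀)
  exact ((Complex.continuous_ofReal.comp (continuous_const.sub h3)).mul h1).add
    ((Complex.continuous_ofReal.comp h3).mul h2)

/-- The chart-straight piece takes values in the image of the chart disc. [folklore] -/
theorem pieceB_mem (hT : Convex ℝ T) (hS : MapsTo ψ T S) (hA : ∀ t, A t i₀ ∈ T)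
    (hB : ∀ t, B t i₀ ∈ T) (q : ℝ × ℝ) : pieceB ψ i₀ A B q ∈ S :=
  hS (pieceB_arg_mem hT hA hB q)

/-- At `s = 0` the piece is `A` (where the chart retracts onto `A`). [folklore] -/
theorem pieceB_zero_left {t : ℝ} (hA : ψ (A t i₀) = A t) : pieceB ψ i₀ A B (0, t) = A t := by
  unfold pieceB
  rw [clamp01_of_nonpos le_rfl, segPoint_zero, hA]

/-- At `s = 1` the piece is `B`. [folklore] -/
theorem pieceB_one_left {t : ℝ} (hB : ψ (B t i₀) = B t) : pieceB ψ i₀ A B (1, t) = B t := by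
  unfold pieceB
  rw [clamp01_of_one_le le_rfl, segPoint_one, hB]

/-- Where `A` and `B` agree the piece is constant in `s`. [folklore] -/
theorem pieceB_of_eq {t : ℝ} (h : A t = B t) (hA : ψ (A t i₀) = A t) (s : ℝ) :
    pieceB ψ i₀ A B (s, t) = A t := by
  unfold pieceB
  simp only
  rw [← h, segPoint_self, hA]

end Pieces

end Summit.KontsevichZagierPeriods.SymplecticScissors.RealOnePeriodRelations.SaHomotopic

namespace Summit.KontsevichZagierPeriods.SymplecticScissors.RealOnePeriodRelations

/-- HELPER STUB `helper_saHomotopic_1` (registered on stmt-KontsevichZagierPeriods-10042): the flat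
cubic step `smoothStep ∘ clamp01` is `C¹` on `ℝ` (= `SaHomotopic.contDiff_flatStep`). [folklore] -/
theorem helper_saHomotopic_1 :
    ContDiff ℝ 1 (fun u : ℝ => smoothStep (clamp01 u)) :=
  SaHomotopic.contDiff_flatStep

end Summit.KontsevichZagierPeriods.SymplecticScissors.RealOnePeriodRelations

end
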